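import Summits.Parity.GeneralizedHardyLittlewood.Theses.LiouvilleMAD
import Summits.Parity.GeneralizedHardyLittlewood.Theorems.LiouvilleMADEngineToGHL
import Summits.Parity.GeneralizedHardyLittlewood.Theorems.LiouvilleMADEngineToGHLIllusory
import Summits.Parity.GeneralizedHardyLittlewood.Theorems.DilatedChowla.Negative.DilatedChowlaMirror
import Literature.Barriers.Parity.SiegelZeroDichotomy
import Literature.NumberTheory.LFunctions.MertensElementary

/-!
# Crux idea `siegel-ledger-recut` — Sketch (crux stmt-Parity-14995 `EngineToGHL`, route LiouvilleMAD,
# crux-ideate round 2, ideator 4)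

Kernel-checked companions of the card `Ideas/siegel-ledger-recut.md`:

* §1 the RE-CUT of the crux at the engine's node, `EngineOutToGHL := DilatedChowla → ElliottHalberstam →
  GeneralizedHardyLittlewood`: it is implied by the crux (`engineOutToGHL_of_engineToGHL`, through the proved
  glue) and it still decides the sub-problem from the route's hypotheses (`closes_recut`); it is NOT offered as a
  Transfer `C⁺ → crux` (wrong direction) but as the END FORM the card recommends to the tenure planner instead of
  `EngineToGHL ↦ PairsToGHL`.
* §2 the SIEGEL LEDGER of the chain as it stands in the tree: the summit bounds Siegel-zero quality
  (`ledger_summit`, modulo Matomäki–Merikoski), the node `DilatedChowla` and the MAD cruxes bound it by `C₀ log q`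
  (`ledger_node`, `ledger_mad` = tree `DilatedChowla.Negative.siegelMirror`), and conjunct 5 as typed can only be
  proved together with a Landau–Siegel statement extracted from the INERT hypothesis `PairsHL` (`ledger_conj5`).
* §3 the card's FIRST LEMMA as a `Prop` over existing declarations: the FOG MIRROR `FogMirror` (quality of a Siegel
  zero `≤ C·(1 + Σ_{p ≤ q, χ(p) ≠ −1} 1/p)` under `DilatedChowla`), its consequence at quality `C₁ log log q`
  (`not_siegelZerosAbove_loglog_of_fogMirror`, PROVED from the Prop and the tree's Mertens bound), and the
  residual `Fog` world it leaves (`fog_of_fogMirror`).  The analytic proof of `FogMirror` is NOT here (card §First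
  lemma: sieve route on the one-point sums `Σ_m λ(qνm+1)`).
-/

namespace Summit.Parity.GeneralizedHardyLittlewood.Cruxes.EngineToGHL.SiegelLedger

open Summit.Parity.GeneralizedHardyLittlewood.Theses
open Summit.Parity.GeneralizedHardyLittlewood.Theses.LiouvilleMAD
open Summit.Parity.GeneralizedHardyLittlewood.Theorems
open Summit.Parity.GeneralizedHardyLittlewood.Theorems.EngineToGHL
open Summit.Parity.GeneralizedHardyLittlewood.Theorems.DilatedChowla.Negative
  (SiegelZerosAbove siegelMirror)
open Literature.Barriers.Parity (IsSiegelZero UnboundedSiegelZeros MatomakiMerikoski2023_pairCorrelation)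
open Finset

noncomputable section

/-! ## §1 The re-cut at the engine's node -/

/-- **The re-cut crux.** The engine's node in front of the summit conjunct: power-saving dilated
two-point Chowla (`DilatedChowla`, stmt-Parity-13319) and Elliott–Halberstam imply Green–Tao's
Conjecture 1.2.  Conjuncts 2–5 of `EngineToGHL` merged into one implication whose hypothesis is
Siegel-INCONSISTENT (tree `siegelMirror`) instead of the Siegel-inert `PairsHL`. -/
def EngineOutToGHL : Prop :=
  DilatedChowla → ElliottHalberstam → _root_.GeneralizedHardyLittlewood

/-- The crux as typed implies the re-cut (through its own conjuncts 2–5): the re-cut is a WEAKER item. -/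
theorem engineOutToGHL_of_engineToGHL (h : EngineToGHL) : EngineOutToGHL := fun hD hEH =>
  h.2.2.2.2 (h.2.2.2.1 (h.2.2.1 (h.2.1 hD)) hEH)

/-- … and it still DECIDES the sub-problem from the route's hypotheses (the would-be `closes` after the
planner's `route edit`): pure logic plus the PROVED support `decorrelationToDilatedChowla_proof`. -/
theorem closes_recut (h₁ : CosetDecorrelation) (h₂ : FanDecorrelation) (hEH : ElliottHalberstam)
    (hX : EngineOutToGHL) : _root_.GeneralizedHardyLittlewood :=
  hX (decorrelationToDilatedChowla_proof h₁ h₂) hEH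

/-- Truth table of the re-cut: true in the GHL world, and (unlike conjunct 5, whose hypothesis `PairsHL`
is Siegel-inert) its hypothesis already fails in the illusory world down to quality `C₀ log q`
(`ledger_node`). -/
theorem engineOutToGHL_of_generalizedHardyLittlewood (hG : _root_.GeneralizedHardyLittlewood) :
    EngineOutToGHL := fun _ _ => hG

/-- The intermediate cut at the Type-II node (conjuncts 3–5 merged) sits between the two. -/
def TypeIIOutToGHL : Prop :=
  TypeIILiouville → ElliottHalberstam → _root_.GeneralizedHardyLittlewood

theorem typeIIOutToGHL_of_engineToGHL (h : EngineToGHL) : TypeIIOutToGHL := fun hT hEH =>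
  h.2.2.2.2 (h.2.2.2.1 (h.2.2.1 hT) hEH)

theorem engineOutToGHL_of_typeIIOutToGHL (h : TypeIIOutToGHL) : EngineOutToGHL := fun hD hEH =>
  h (dilatedChowlaToTypeII_proof hD) hEH

/-! ## §2 The Siegel ledger of the chain (tree facts, assembled) -/

/-- LEDGER, summit entry: Green–Tao's Conjecture 1.2 as typed bounds the quality of Siegel zeros at
large conductors (tree `PairsToGHL.Negative.not_generalizedHardyLittlewood_of_unboundedSiegelZeros`,
modulo the vendored Matomäki–Merikoski Theorem 1.3). -/
theorem ledger_summit (hMM : MatomakiMerikoski2023_pairCorrelation)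
    (hG : _root_.GeneralizedHardyLittlewood) : ¬ UnboundedSiegelZeros := fun hU =>
  PairsToGHL.Negative.not_generalizedHardyLittlewood_of_unboundedSiegelZeros hMM hU hG

/-- LEDGER, node entry: the engine's node already repels Siegel zeros of quality `≥ C₀ log q`
(tree `DilatedChowla.Negative.siegelMirror`, card `siegel-mirror` of crux stmt-Parity-13319). -/
theorem ledger_node (hD : DilatedChowla) :
    ∃ C₀ : ℝ, 0 < C₀ ∧ ¬ SiegelZerosAbove (fun q => C₀ * Real.log q) :=
  siegelMirror hD

/-- LEDGER, MAD entry: so do the route's rank-2/3 cruxes, through the proved divisor-switch glue. -/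
theorem ledger_mad (h₁ : CosetDecorrelation) (h₂ : FanDecorrelation) :
    ∃ C₀ : ℝ, 0 < C₀ ∧ ¬ SiegelZerosAbove (fun q => C₀ * Real.log q) :=
  siegelMirror (decorrelationToDilatedChowla_proof h₁ h₂)

/-- LEDGER, conjunct-5 entry: any proof of the crux AS TYPED yields, from the Siegel-inert `PairsHL`
alone, bounded Siegel quality (tree `siegelZeros_bounded_of_engineToGHL`) — the jump the ledger must
make at the last junction when the cut is `PairsHL | GHL`. -/
theorem ledger_conj5 (hMM : MatomakiMerikoski2023_pairCorrelation) (hX : EngineToGHL)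
    (hP : LiouvilleShiftedTables.PairsHL) :
    ∃ η₀ : ℝ, ∃ q₀ : ℕ, ∀ (q : ℕ) [NeZero q] (χ : DirichletCharacter ℂ q) (η : ℝ),
      q₀ ≤ q → IsSiegelZero χ η → η < η₀ :=
  siegelZeros_bounded_of_engineToGHL hMM hX hP

/-! ## §3 The first lemma: the fog mirror -/

/-- The `1/p`-mass of the EXCEPTIONAL primes `p ≤ q` of `χ mod q` (`χ(p) ≠ −1`: split or ramified;
Tao–Teräväinen §2.3).  It lies in `[0, log log q + 4]` (`splitPrimeMass_le`). -/
def splitPrimeMass (q : ℕ) (χ : DirichletCharacter ℂ q) : ℝ :=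
  ∑ p ∈ (Nat.primesLE q).filter (fun p : ℕ => χ ((p : ℕ) : ZMod q) ≠ -1), (1 : ℝ) / (p : ℝ)

theorem splitPrimeMass_nonneg (q : ℕ) (χ : DirichletCharacter ℂ q) : 0 ≤ splitPrimeMass q χ :=
  sum_nonneg fun _ _ => by positivity

/-- Mertens: `splitPrimeMass q χ ≤ log log q + 4` for `q ≥ 2` (tree `MertensBound.sum_inv_prime_le`). -/
theorem splitPrimeMass_le {q : ℕ} (hq : 2 ≤ q) (χ : DirichletCharacter ℂ q) :
    splitPrimeMass q χ ≤ Real.log (Real.log q) + 4 := by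
  refine le_trans ?_ (Literature.NumberTheory.LFunctions.MertensBound.sum_inv_prime_le q hq)
  unfold splitPrimeMass
  exact sum_le_sum_of_subset_of_nonneg (filter_subset _ _) fun p _ _ => by positivity

/-- **FIRST LEMMA (the fog mirror).** Under the engine's node, a Siegel zero of quality `η`
(Tao–Teräväinen Definition 1.4, tree `IsSiegelZero`) at a large conductor `q` must come with
exceptional-prime mass `Σ_{p ≤ q, χ(p) ≠ −1} 1/p ≥ η/C − 1`: the quality is bounded by the density of
small split/ramified primes.  To be proved by the SIEVE route on the one-point class sums
`Σ_{m ∈ (M,2M]} λ(qνm + 1)` (card §First lemma); expected size XL. -/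
def FogMirror : Prop :=
  DilatedChowla → ∃ C : ℝ, 0 < C ∧ ∃ q₀ : ℕ, ∀ (q : ℕ) [NeZero q] (χ : DirichletCharacter ℂ q) (η : ℝ),
    q₀ ≤ q → IsSiegelZero χ η → η ≤ C * (1 + splitPrimeMass q χ)

/-- The fog mirror improves the tree's `siegelMirror` from quality `C₀ log q` to `C₁ log log q`:
under it, `DilatedChowla` excludes Siegel zeros of quality `≥ C₁ log log q` at large conductors. -/
theorem not_siegelZerosAbove_loglog_of_fogMirror (hF : FogMirror) (hD : DilatedChowla) :
    ∃ C₁ : ℝ, 0 < C₁ ∧ ¬ SiegelZerosAbove (fun q => C₁ * Real.log (Real.log q)) := by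
  obtain ⟨C, hC, q₀, h⟩ := hF hD
  -- `η ≤ C (5 + log log q) ≤ 6C log log q` once `log log q ≥ 5`, i.e. `q ≥ ⌈exp (exp 5)⌉`
  refine ⟨6 * C + 1, by positivity, fun hz => ?_⟩
  obtain ⟨q, hq, χ, η, hq₀, hQ, hζ⟩ := hz (max q₀ (⌈Real.exp (Real.exp 5)⌉₊ + 2))
  have hq₀' : q₀ ≤ q := le_trans (le_max_left _ _) hq₀
  have hq2 : 2 ≤ q := le_trans (by omega) (le_trans (le_max_right _ _) hq₀)
  have hqe : Real.exp (Real.exp 5) ≤ q := by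
    have h1 : (⌈Real.exp (Real.exp 5)⌉₊ : ℝ) ≤ q := by
      exact_mod_cast le_trans (Nat.le_succ_of_le (Nat.le_succ _)) (le_trans (le_max_right _ _) hq₀)
    exact le_trans (Nat.le_ceil _) h1
  have hll : 5 ≤ Real.log (Real.log q) := by
    have h1 : Real.exp 5 ≤ Real.log q := by
      rw [← Real.log_exp (Real.exp 5)]
      exact Real.log_le_log (Real.exp_pos _) hqe
    calc (5 : ℝ) = Real.log (Real.exp 5) := (Real.log_exp 5).symm
      _ ≤ Real.log (Real.log q) := Real.log_le_log (Real.exp_pos _) h1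
  have hbound := h q χ η hq₀' hζ
  have hs := splitPrimeMass_le hq2 χ
  have hQ' : (6 * C + 1) * Real.log (Real.log q) ≤ η := hQ
  have h3 : η ≤ C * (5 + Real.log (Real.log q)) := by nlinarith
  have hpos : (0 : ℝ) < Real.log (Real.log q) - 1 := by linarith
  have h4 : C * (5 + Real.log (Real.log q)) < (6 * C + 1) * Real.log (Real.log q) := by
    nlinarith [mul_pos hC hpos]
  linarith

/-- **The fog.** What the fog mirror leaves of the illusory world under the engine's node: Siegel
zeros of quality `η` survive only for characters with exceptional-prime mass `≥ η/C − 1` — dense tiny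
split primes ("the split-prime fog", card §Barriers). -/
theorem fog_of_fogMirror (hF : FogMirror) (hD : DilatedChowla) :
    ∃ C : ℝ, 0 < C ∧ ∃ q₀ : ℕ, ∀ (q : ℕ) [NeZero q] (χ : DirichletCharacter ℂ q) (η : ℝ),
      q₀ ≤ q → IsSiegelZero χ η → η / C - 1 ≤ splitPrimeMass q χ := by
  obtain ⟨C, hC, q₀, h⟩ := hF hD
  refine ⟨C, hC, q₀, fun q _ χ η hq hz => ?_⟩
  have h1 : η ≤ C * (1 + splitPrimeMass q χ) := h q χ η hq hz
  have h2 : η / C ≤ 1 + splitPrimeMass q χ := by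
    rw [div_le_iff₀ hC]; linarith [mul_comm C (1 + splitPrimeMass q χ)]
  linarith

/-- In particular the fog needs ROOM: quality `η` forces `log log q ≥ η/C − 5`, i.e. conductors doubly
exponential in the quality (Mertens). -/
theorem loglog_ge_of_fogMirror (hF : FogMirror) (hD : DilatedChowla) :
    ∃ C : ℝ, 0 < C ∧ ∃ q₀ : ℕ, ∀ (q : ℕ) [NeZero q] (χ : DirichletCharacter ℂ q) (η : ℝ),
      q₀ ≤ q → IsSiegelZero χ η → η / C - 5 ≤ Real.log (Real.log q) := by
  obtain ⟨C, hC, q₀, h⟩ := fog_of_fogMirror hF hD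
  refine ⟨C, hC, max q₀ 2, fun q _ χ η hq hz => ?_⟩
  have h1 := h q χ η (le_trans (le_max_left _ _) hq) hz
  have h2 := splitPrimeMass_le (le_trans (le_max_right _ _) hq) χ
  linarith

/-- Consistency: the open no-Siegel-zero statement rh.S34 (tree `NoSiegelZeros`) implies the conclusion of
the fog mirror outright (bounded quality at all conductors `≥ 3`), so `FogMirror` is expected TRUE — a
hardness certificate for the node, never a refutation. -/
theorem fogMirror_conclusion_of_noSiegelZeros
    (h : Literature.NumberTheory.LFunctions.NoSiegelZeros) :
    ∃ C : ℝ, 0 < C ∧ ∃ q₀ : ℕ, ∀ (q : ℕ) [NeZero q] (χ : DirichletCharacter ℂ q) (η : ℝ),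
      q₀ ≤ q → IsSiegelZero χ η → η ≤ C * (1 + splitPrimeMass q χ) := by
  have hno := Literature.Barriers.Parity.not_unboundedSiegelZeros_of_noSiegelZeros h
  -- `¬UnboundedSiegelZeros` gives `η₀, q₀` with `η < η₀` beyond `q₀`
  simp only [UnboundedSiegelZeros, not_forall, not_exists, not_and] at hno
  obtain ⟨η₀, q₀, hηq⟩ := hno
  refine ⟨max η₀ 1, by positivity, q₀, fun q _ χ η hq hz => ?_⟩
  have h1 : ¬ (η₀ ≤ η) := fun hle => hηq q ‹_› χ η hq hle hz
  have h2 : η < η₀ := lt_of_not_ge h1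
  have h3 : 0 ≤ splitPrimeMass q χ := splitPrimeMass_nonneg q χ
  nlinarith [le_max_left η₀ 1, le_max_right η₀ 1]

end

end Summit.Parity.GeneralizedHardyLittlewood.Cruxes.EngineToGHL.SiegelLedger
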